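import Literature.NumberTheory.LFunctions.RodgersTaoEnergyV5
import Literature.NumberTheory.LFunctions.RodgersTaoEnergyProofs
import HarnessLib

/-!
# Rodgers–Tao, §8 (arXiv v5): the good interval from Thm. 7.2, and Prop. 8.1 from the v5 leaves

Trunk T-ANT (`Literature/NumberTheory/LFunctions`). Proofs only (no definitions, no named facts).
Companion of `RodgersTaoEnergyV5.lean`, which states the corrected §8 of B. Rodgers, T. Tao,
*The de Bruijn–Newman constant is non-negative* (arXiv:1801.05914v5, 2021; Forum Math. Pi 8
(2020), e6): Prop. 8.2 (v5) "Locating a good interval" (the predicate `GoodIntervalBound t₀` in the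
witness `t₀` of `Λ < 0`) and Prop. 8.3 (v5) "Energy propagation inequality"
(`EnergyPropagationV5 t₀`). The regularity of the zeros enters as explicit hypotheses: their
ordering `0 < x₁(t) < x₂(t) < ⋯` for `t₀ < t ≤ 0` (§1.2 of the source, after
Csordas–Smith–Varga; here only `StrictMono (j ↦ x_{j+1}(t))` is used) and the continuity of each
`t ↦ x_j(t)` on `(t₀, 0]` (Thm. 4.1). No named fact is introduced or discharged (D-0026); all
results are implications between the statements of the source. Here we prove:

* `Literature.NumberTheory.LFunctions.goodIntervalBound_of_integrated_energy_bound` —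
  **Prop. 8.2 (v5) from Thm. 7.2** (`rodgers_tao_integrated_energy_bound`) and the regularity of
  the zeros: the printed proof (pigeonholing the pair of endpoints, Fubini–Tonelli, Thm. 7.2),
  with the average taken over integer endpoints;
* `Literature.NumberTheory.LFunctions.energy_bound_zero_of_propagation_v5` —
  **Prop. 8.1 from Thm. 7.2, Prop. 8.2 (v5), Prop. 8.3 (v5)** and the ordering of the zeros, at a
  fixed time `t₀ < 0` (the conclusions of Thm. 7.2 and Props. 8.2, 8.3 (v5) at `t₀` as hypotheses,
  the bound `Ẽ^{[TL, 2TL]}(0) = o(T log³ T)` as conclusion): the printed deduction (a good starting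
  time by Thm. 7.2 and pigeonholing, monotonicity of `Ẽ^I` in `I` to pass to `I⁰`, `O(log² T)`
  applications of Prop. 8.3 starting from `I⁰`, which shrink the window by `O(log⁵ T)` in total
  and cost `Õ(1)` each, monotonicity of `Ẽ^I(0)` in `I`).

At the witness `t₀` of `Λ < 0` these two theorems give the named fact
`Literature.NumberTheory.LFunctions.rodgers_tao_energy_bound_zero` (Prop. 8.1) verbatim from
Thm. 7.2, Prop. 8.3 (v5) (as `∀ t₀ < 0, HasOnlyRealZeros (deBruijnH t₀) → EnergyPropagationV5 t₀`)
and the two regularity hypotheses, and from it the picket-fence estimate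
`Literature.NumberTheory.LFunctions.rodgers_tao_picket_fence` and Thm. 1.1
(`Literature.NumberTheory.LFunctions.rodgers_tao`) by `rodgers_tao_picket_fence_of_energy_bound`
(`RodgersTaoEnergyProofs.lean`, with the zeros at time `0`, `rodgers_tao_zeros_zero_holds`) and
`rodgers_tao_of_picket_fence` (`RodgersTaoProofs.lean`, with the Riemann–von Mangoldt formula and
the Selberg–Fujii small-gap theorem). Earlier versions of this file carried these three
end-to-end assemblies as declarations (`rodgers_tao_energy_bound_zero_of_v5`,
`rodgers_tao_picket_fence_of_v5`, `rodgers_tao_of_v5`). They were removed on 2026-08-15: their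
conclusions are closed theorems of the tree — `rodgers_tao_energy_bound_zero_holds`
(`RodgersTaoEnergyProofs.lean`), `rodgers_tao_picket_fence_holds` (`RodgersTaoHolds.lean`) and
`rodgers_tao_holds` (`DobnerLemma4Proofs.lean`, Thm. 1.1 proved along Dobner's independent route,
which refutes the standing hypothesis `Λ < 0` of all these statements) — of which they had become
restatements (gate alias probe). The composable reductions listed above are unchanged.

## The argument for Prop. 8.2 (v5)

Fix the witness `t₀` and take `ε = 1` in Thm. 7.2: for `T ≥ T₁`, `F(t) = Ẽ^{[½TL, 3TL]}(t)` is
integrable on `[t₀/4, 0]` with `∫ F ≤ T L³` (`L = log T`). Let `P₁ = [0.8TL, 0.9TL] ∩ ℕ`,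
`P₂ = [2.1TL, 2.2TL] ∩ ℕ` (each of size `≥ TL/10 − 1 ≥ TL/20`) and `D = {n : 2ⁿ ≤ TL/10}`
(`|D| ≤ 4L`). For `t ∈ [t₀/4, 0]` the zeros are ordered, so the
energies `Ẽ_{jk}(t)` of positive indices are `≥ 0`, and for `a ∈ P₁ ∪ P₂`, `n ∈ D` the window
`[a − 2ⁿ, a + 2ⁿ]` lies in `[½TL, 3TL]`; a pair `(j, k)` lies in at most `2 · 2ⁿ + 1` of the windows
`[a − 2ⁿ, a + 2ⁿ]`, `a ∈ P_i`, whence `Σ_{a ∈ P_i} Ẽ^{[a − 2ⁿ, a + 2ⁿ]}(t) ≤ (2 · 2ⁿ + 1) F(t)` and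
`Σ_{(a,b) ∈ P₁ × P₂} boundaryEnergy(a, b)(t) ≤ 12 L (|P₁| + |P₂|) F(t)`. The boundary energies are
continuous in `t` (Thm. 4.1), hence integrable, and integrating gives
`Σ_{(a,b)} ∫ boundaryEnergy(a,b) ≤ 12 (|P₁| + |P₂|) T L⁴ ≤ |P₁| |P₂| · 480 L³`, so some pair has
`∫ ≤ 480 L³`.

## References

* B. Rodgers, T. Tao, *The de Bruijn–Newman constant is non-negative*, Forum Math. Pi 8 (2020),
  e6; arXiv:1801.05914v5 (2021), §8.
-/

noncomputable section

open Real Filter Set MeasureTheory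

namespace Literature.NumberTheory.LFunctions

/-! ## Scales, windows and candidate endpoints at a fixed height `T` -/

/-- The dyadic scales are few: if `e ≤ T` then every `n ∈ dyadicScales T` has `n ≤ 3 log T`
(`2ⁿ ≤ T log T / 10 ≤ T²` and `log 2 > 2/3`). [folklore] -/
theorem le_of_mem_dyadicScales {T : ℝ} (hT : Real.exp 1 ≤ T) {n : ℕ} (hn : n ∈ dyadicScales T) :
    (n : ℝ) ≤ 3 * Real.log T := by
  have h2n := two_pow_le_of_mem_dyadicScales hn
  have hT0 : 0 < T := (Real.exp_pos 1).trans_le hT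
  have hL1 : 1 ≤ Real.log T := (Real.le_log_iff_exp_le hT0).2 hT
  have hLT : Real.log T ≤ T := (Real.log_le_sub_one_of_pos hT0).trans (by linarith)
  have hsq : (2 : ℝ) ^ n ≤ T ^ 2 := by
    have : T * Real.log T / 10 ≤ T ^ 2 := by
      rw [div_le_iff₀ (by norm_num : (0 : ℝ) < 10)]
      nlinarith
    exact h2n.trans this
  have hlog : (n : ℝ) * Real.log 2 ≤ 2 * Real.log T := by
    have := Real.log_le_log (by positivity) hsq
    rwa [Real.log_pow, Real.log_pow, Nat.cast_ofNat] at this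
  nlinarith [Real.log_two_gt_d9, Nat.cast_nonneg (α := ℝ) n]

/-- Hence `|dyadicScales T| ≤ 4 log T` for `T ≥ e`. [folklore] -/
theorem card_dyadicScales_le {T : ℝ} (hT : Real.exp 1 ≤ T) :
    ((dyadicScales T).card : ℝ) ≤ 4 * Real.log T := by
  have hT0 : 0 < T := (Real.exp_pos 1).trans_le hT
  have hL1 : 1 ≤ Real.log T := (Real.le_log_iff_exp_le hT0).2 hT
  have hsub : dyadicScales T ⊆ Finset.range (⌊3 * Real.log T⌋₊ + 1) := by
    intro n hn
    rw [Finset.mem_range]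
    exact Nat.lt_succ_of_le (Nat.le_floor (le_of_mem_dyadicScales hT hn))
  have h1 := Finset.card_le_card hsub
  rw [Finset.card_range] at h1
  have h2 : ((dyadicScales T).card : ℝ) ≤ ⌊3 * Real.log T⌋₊ + 1 := by exact_mod_cast h1
  have h3 : (⌊3 * Real.log T⌋₊ : ℝ) ≤ 3 * Real.log T := Nat.floor_le (by positivity)
  linarith

/-- The windows of Prop. 8.2 (v5) at an admissible endpoint `a ∈ [0.8 TL, 2.2 TL]` and a dyadic
scale `2ⁿ ≤ TL/10` consist of positive indices and lie inside `[½TL, 3TL]`, provided `TL ≥ 10`.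
[folklore] -/
theorem window_subset {T : ℝ} {a n : ℕ} (hTL : 10 ≤ T * Real.log T)
    (ha : 4 / 5 * (T * Real.log T) ≤ a) (ha' : (a : ℝ) ≤ 11 / 5 * (T * Real.log T))
    (hn : n ∈ dyadicScales T) :
    2 ^ n ≤ a ∧ T * Real.log T / 2 ≤ ((a - 2 ^ n : ℕ) : ℝ) ∧
      ((a + 2 ^ n : ℕ) : ℝ) ≤ 3 * T * Real.log T ∧
      Finset.Icc (a - 2 ^ n) (a + 2 ^ n) ⊆
        Finset.Icc ⌈T * Real.log T / 2⌉₊ ⌊3 * T * Real.log T⌋₊ ∧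
      ∀ j ∈ Finset.Icc (a - 2 ^ n) (a + 2 ^ n), 1 ≤ j := by
  have h2n := two_pow_le_of_mem_dyadicScales hn
  have h2n' : (((2 ^ n : ℕ) : ℝ)) ≤ T * Real.log T / 10 := by push_cast; exact h2n
  have hle : 2 ^ n ≤ a := by
    have : ((2 ^ n : ℕ) : ℝ) ≤ a := h2n'.trans (by linarith)
    exact_mod_cast this
  have hsub : ((a - 2 ^ n : ℕ) : ℝ) = a - ((2 ^ n : ℕ) : ℝ) := Nat.cast_sub hle
  have hlo : T * Real.log T / 2 ≤ ((a - 2 ^ n : ℕ) : ℝ) := by rw [hsub]; linarith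
  have hhi : ((a + 2 ^ n : ℕ) : ℝ) ≤ 3 * T * Real.log T := by push_cast at h2n' ⊢; linarith
  have hpos : 1 ≤ a - 2 ^ n := by
    have : (1 : ℝ) ≤ ((a - 2 ^ n : ℕ) : ℝ) := by linarith
    exact_mod_cast this
  refine ⟨hle, hlo, hhi, Finset.Icc_subset_Icc (Nat.ceil_le.2 hlo) (Nat.le_floor hhi), ?_⟩
  intro j hj
  rw [Finset.mem_Icc] at hj
  omega

/-- Size of a discrete interval with real endpoints: `#([x, y] ∩ ℕ) ≥ y − x − 1` for `0 ≤ x`.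
[folklore] -/
theorem sub_sub_one_le_card_Icc {x y : ℝ} (hx : 0 ≤ x) :
    y - x - 1 ≤ ((Finset.Icc ⌈x⌉₊ ⌊y⌋₊).card : ℝ) := by
  rw [Nat.card_Icc]
  have h1 : (⌈x⌉₊ : ℝ) < x + 1 := Nat.ceil_lt_add_one hx
  have h2 : y < ⌊y⌋₊ + 1 := Nat.lt_floor_add_one y
  rcases le_or_gt ⌈x⌉₊ (⌊y⌋₊ + 1) with h | h
  · rw [Nat.cast_sub h]
    push_cast
    linarith
  · have : ((⌊y⌋₊ + 1 : ℕ) : ℝ) < ⌈x⌉₊ := by exact_mod_cast h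
    push_cast at this
    have h0 : (0 : ℝ) ≤ ((⌊y⌋₊ + 1 - ⌈x⌉₊ : ℕ) : ℝ) := Nat.cast_nonneg _
    linarith

/-! ## Counting windows through a pair: the Fubini–Tonelli step of Prop. 8.2 (v5) -/

/-- A pair of indices lies in at most `2m + 1` of the windows `[a − m, a + m]`, so summing a
non-negative pair function over the off-diagonals of the windows `[a − m, a + m]`, `a ∈ P`, all
contained in `big`, gives at most `(2m + 1)` times its sum over `big.offDiag` (the estimate
`∫∫ Ẽ^{[I⁰_± − 2ⁿ, I⁰_± + 2ⁿ]} dI⁰₊ dI⁰₋ ≲ 2ⁿ T Ẽ^{[½TL, 3TL]}` of the source, discretised).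
[cite: RodgersTaoFMP2020, arXiv v5 Prop. 8.2 (proof)] -/
theorem sum_sum_offDiag_window_le {f : ℕ × ℕ → ℝ} {big P : Finset ℕ} {m : ℕ}
    (hsub : ∀ a ∈ P, Finset.Icc (a - m) (a + m) ⊆ big) (hf : ∀ p ∈ big.offDiag, 0 ≤ f p) :
    ∑ a ∈ P, ∑ p ∈ (Finset.Icc (a - m) (a + m)).offDiag, f p ≤
      (2 * m + 1) * ∑ p ∈ big.offDiag, f p := by
  classical
  have hstep : ∀ a ∈ P, ∑ p ∈ (Finset.Icc (a - m) (a + m)).offDiag, f p =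
      ∑ p ∈ big.offDiag, if p ∈ (Finset.Icc (a - m) (a + m)).offDiag then f p else 0 := by
    intro a ha
    rw [← Finset.sum_filter, Finset.filter_mem_eq_inter,
      Finset.inter_eq_right.2 (Finset.offDiag_mono (hsub a ha))]
  rw [Finset.sum_congr rfl hstep, Finset.sum_comm, Finset.mul_sum]
  refine Finset.sum_le_sum fun p hp ↦ ?_
  rw [← Finset.sum_filter, Finset.sum_const, nsmul_eq_mul]
  refine mul_le_mul_of_nonneg_right ?_ (hf p hp)
  have hcard : (P.filter fun a ↦ p ∈ (Finset.Icc (a - m) (a + m)).offDiag).card ≤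
      (Finset.Icc (p.1 - m) (p.1 + m)).card := by
    refine Finset.card_le_card fun a ha ↦ ?_
    simp only [Finset.mem_filter, Finset.mem_offDiag, Finset.mem_Icc] at ha ⊢
    omega
  have hcard' : (Finset.Icc (p.1 - m) (p.1 + m)).card ≤ 2 * m + 1 := by
    rw [Nat.card_Icc]; omega
  exact_mod_cast hcard.trans hcard'

/-- The pointwise estimate of Prop. 8.2 (v5): at a time at which the positive-index zeros are
ordered, for `TL ≥ 10`, `T ≥ e` and admissible endpoints `a ∈ P ⊆ [0.8TL, 2.2TL]`,
`Σ_{a ∈ P} Σ_{2ⁿ ≤ TL/10} 2⁻ⁿ Ẽ^{[a − 2ⁿ, a + 2ⁿ]}(t) ≤ 12 log T · Ẽ^{[½TL, 3TL]}(t)`.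
[cite: RodgersTaoFMP2020, arXiv v5 Prop. 8.2 (proof)] -/
theorem sum_windowEnergy_le {T t : ℝ} (hTL : 10 ≤ T * Real.log T) (hTe : Real.exp 1 ≤ T)
    (hmono : StrictMono fun j : ℕ ↦ deBruijnZero t (j + 1)) {P : Finset ℕ}
    (hP : ∀ a ∈ P, 4 / 5 * (T * Real.log T) ≤ a ∧ (a : ℝ) ≤ 11 / 5 * (T * Real.log T)) :
    ∑ a ∈ P, ∑ n ∈ dyadicScales T,
        ((2 : ℝ) ^ n)⁻¹ * renormEnergyOn t (Finset.Icc (a - 2 ^ n) (a + 2 ^ n)) ≤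
      12 * Real.log T *
        renormEnergyOn t (Finset.Icc ⌈T * Real.log T / 2⌉₊ ⌊3 * T * Real.log T⌋₊) := by
  set big : Finset ℕ := Finset.Icc ⌈T * Real.log T / 2⌉₊ ⌊3 * T * Real.log T⌋₊ with hbig
  have hT0 : 0 < T := (Real.exp_pos 1).trans_le hTe
  have hbig1 : ∀ j ∈ big, 1 ≤ j := by
    intro j hj
    rw [hbig, Finset.mem_Icc] at hj
    exact le_trans (Nat.one_le_ceil_iff.2 (by positivity)) hj.1
  have hF0 : 0 ≤ renormEnergyOn t big := renormEnergyOn_nonneg_of_strictMono hmono hbig1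
  have hf : ∀ p ∈ big.offDiag, 0 ≤ renormEnergy t p.1 p.2 := by
    intro p hp
    rw [Finset.mem_offDiag] at hp
    exact renormEnergy_nonneg_of_strictMono hmono (hbig1 _ hp.1) (hbig1 _ hp.2.1) hp.2.2
  rw [Finset.sum_comm]
  -- each scale contributes at most `3 Ẽ^{big}(t)`
  have hscale : ∀ n ∈ dyadicScales T,
      ∑ a ∈ P, ((2 : ℝ) ^ n)⁻¹ * renormEnergyOn t (Finset.Icc (a - 2 ^ n) (a + 2 ^ n)) ≤
        3 * renormEnergyOn t big := by
    intro n hn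
    rw [← Finset.mul_sum]
    have hwin := sum_sum_offDiag_window_le (f := fun p ↦ renormEnergy t p.1 p.2) (P := P)
      (m := 2 ^ n) (big := big)
      (fun a ha ↦ (window_subset hTL (hP a ha).1 (hP a ha).2 hn).2.2.2.1) hf
    simp only [← renormEnergyOn_eq] at hwin
    have h2 : (0 : ℝ) < (2 : ℝ) ^ n := by positivity
    calc ((2 : ℝ) ^ n)⁻¹ * ∑ a ∈ P, renormEnergyOn t (Finset.Icc (a - 2 ^ n) (a + 2 ^ n))
        ≤ ((2 : ℝ) ^ n)⁻¹ * ((2 * (2 ^ n : ℕ) + 1) * renormEnergyOn t big) :=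
          mul_le_mul_of_nonneg_left hwin (by positivity)
      _ = (2 + ((2 : ℝ) ^ n)⁻¹) * renormEnergyOn t big := by
          push_cast
          field_simp
      _ ≤ 3 * renormEnergyOn t big := by
          refine mul_le_mul_of_nonneg_right ?_ hF0
          have : ((2 : ℝ) ^ n)⁻¹ ≤ 1 := inv_le_one_of_one_le₀ (one_le_pow₀ (by norm_num))
          linarith
  calc ∑ n ∈ dyadicScales T, ∑ a ∈ P,
          ((2 : ℝ) ^ n)⁻¹ * renormEnergyOn t (Finset.Icc (a - 2 ^ n) (a + 2 ^ n))
      ≤ ∑ n ∈ dyadicScales T, 3 * renormEnergyOn t big := Finset.sum_le_sum hscale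
    _ = 3 * (dyadicScales T).card * renormEnergyOn t big := by
        rw [Finset.sum_const, nsmul_eq_mul]; ring
    _ ≤ 3 * (4 * Real.log T) * renormEnergyOn t big := by
        gcongr
        exact card_dyadicScales_le hTe
    _ = 12 * Real.log T * renormEnergyOn t big := by ring

/-! ## Continuity in time of the window energies (from Thm. 4.1) and their integrability -/

/-- If on `(t₀, 0]` the positive-index zeros are ordered at each time and each `t ↦ x_j(t)` is
continuous (§1.2 and Thm. 4.1 of the source), then `t ↦ Ẽ_{jk}(t)` is continuous on `(t₀, 0]` for
distinct positive indices (the zeros never collide there and `V` is continuous off `0`).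
[cite: RodgersTaoFMP2020, Thm. 4.1 and §7] -/
theorem continuousOn_renormEnergy {t₀ : ℝ}
    (hord : ∀ t ∈ Ioc t₀ 0, StrictMono fun j : ℕ ↦ deBruijnZero t (j + 1))
    (hcont : ∀ j : ℕ, ContinuousOn (fun t : ℝ ↦ deBruijnZero t (j + 1)) (Ioc t₀ 0))
    {j k : ℕ} (hj : 1 ≤ j) (hk : 1 ≤ k) (hjk : j ≠ k) :
    ContinuousOn (fun t ↦ renormEnergy t j k) (Ioc t₀ 0) := by
  obtain ⟨m₁, rfl⟩ : ∃ m, j = m + 1 := ⟨j - 1, by omega⟩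
  obtain ⟨m₂, rfl⟩ : ∃ m, k = m + 1 := ⟨k - 1, by omega⟩
  have hne : m₁ ≠ m₂ := fun h ↦ hjk (by rw [h])
  set c : ℝ := classicalLocation ((m₂ + 1 : ℕ) : ℝ) - classicalLocation ((m₁ + 1 : ℕ) : ℝ)
    with hc
  have hc0 : c ≠ 0 := by
    refine sub_ne_zero.2 fun h ↦ hjk ?_
    have h1 : ((m₂ + 1 : ℕ) : ℝ) ∈ Ici (-1 : ℝ) := by
      simp only [mem_Ici]; exact le_trans (by norm_num) (Nat.cast_nonneg _)
    have h2 : ((m₁ + 1 : ℕ) : ℝ) ∈ Ici (-1 : ℝ) := by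
      simp only [mem_Ici]; exact le_trans (by norm_num) (Nat.cast_nonneg _)
    exact_mod_cast (strictMonoOn_classicalLocation.injOn h1 h2 h).symm
  have hg : ContinuousOn (fun t ↦ (deBruijnZero t (m₂ + 1) - deBruijnZero t (m₁ + 1)) / c)
      (Ioc t₀ 0) :=
    ((hcont m₂).sub (hcont m₁)).div_const c
  have hV : ContinuousOn
      (fun t ↦ renormPotential ((deBruijnZero t (m₂ + 1) - deBruijnZero t (m₁ + 1)) / c) / c ^ 2)
      (Ioc t₀ 0) := by
    refine ContinuousOn.div_const (fun t ht ↦ ?_) _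
    refine (continuousAt_renormPotential ?_).comp_continuousWithinAt (hg t ht)
    exact div_ne_zero (sub_ne_zero.2 fun h ↦ hne.symm ((hord t ht).injective h)) hc0
  refine hV.congr fun t _ ↦ ?_
  rw [renormEnergy_eq]

/-- Under the same regularity hypotheses, `t ↦ Ẽ^W(t)` is continuous on `(t₀, 0]` for every finite
set `W` of positive indices. [cite: RodgersTaoFMP2020, Thm. 4.1 and §7] -/
theorem continuousOn_renormEnergyOn {t₀ : ℝ}
    (hord : ∀ t ∈ Ioc t₀ 0, StrictMono fun j : ℕ ↦ deBruijnZero t (j + 1))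
    (hcont : ∀ j : ℕ, ContinuousOn (fun t : ℝ ↦ deBruijnZero t (j + 1)) (Ioc t₀ 0))
    {W : Finset ℕ} (hW : ∀ j ∈ W, 1 ≤ j) :
    ContinuousOn (fun t ↦ renormEnergyOn t W) (Ioc t₀ 0) := by
  have h : (fun t ↦ renormEnergyOn t W) = fun t ↦ ∑ p ∈ W.offDiag, renormEnergy t p.1 p.2 :=
    funext fun t ↦ renormEnergyOn_eq t W
  rw [h]
  refine continuousOn_finsetSum _ fun p hp ↦ ?_
  rw [Finset.mem_offDiag] at hp
  exact continuousOn_renormEnergy hord hcont (hW _ hp.1) (hW _ hp.2.1) hp.2.2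

/-- Under the same regularity hypotheses, the dyadic boundary energy `t ↦ boundaryEnergy T a b t`
is continuous on `(t₀, 0]` whenever all its windows consist of positive indices.
[cite: RodgersTaoFMP2020, Thm. 4.1 and arXiv v5 Prop. 8.2] -/
theorem continuousOn_boundaryEnergy {t₀ : ℝ}
    (hord : ∀ t ∈ Ioc t₀ 0, StrictMono fun j : ℕ ↦ deBruijnZero t (j + 1))
    (hcont : ∀ j : ℕ, ContinuousOn (fun t : ℝ ↦ deBruijnZero t (j + 1)) (Ioc t₀ 0))
    {T : ℝ} {a b : ℕ}
    (ha : ∀ n ∈ dyadicScales T, ∀ j ∈ Finset.Icc (a - 2 ^ n) (a + 2 ^ n), 1 ≤ j)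
    (hb : ∀ n ∈ dyadicScales T, ∀ j ∈ Finset.Icc (b - 2 ^ n) (b + 2 ^ n), 1 ≤ j) :
    ContinuousOn (boundaryEnergy T a b) (Ioc t₀ 0) := by
  have h : boundaryEnergy T a b = fun t ↦ ∑ n ∈ dyadicScales T, ((2 : ℝ) ^ n)⁻¹ *
      (renormEnergyOn t (Finset.Icc (a - 2 ^ n) (a + 2 ^ n)) +
        renormEnergyOn t (Finset.Icc (b - 2 ^ n) (b + 2 ^ n))) :=
    funext fun t ↦ boundaryEnergy_eq T a b t
  rw [h]
  refine continuousOn_finsetSum _ fun n hn ↦ ?_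
  exact continuousOn_const.mul ((continuousOn_renormEnergyOn hord hcont (ha n hn)).add
    (continuousOn_renormEnergyOn hord hcont (hb n hn)))

/-- `[t₀/4, 0] ⊆ (t₀, 0]` for `t₀ < 0`. [folklore] -/
theorem Icc_quarter_subset_Ioc {t₀ : ℝ} (ht₀ : t₀ < 0) : Icc (t₀ / 4) 0 ⊆ Ioc t₀ 0 :=
  fun _ ht ↦ ⟨by linarith [ht.1], ht.2⟩

/-! ## Prop. 8.2 (v5) from Thm. 7.2 -/

/-- **Rodgers–Tao, arXiv v5, Prop. 8.2 (Locating a good interval) from Thm. 7.2.** Under `Λ < 0`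
(witness `t₀`), the integrated energy bound `∫_{t₀/4}^0 Ẽ^{[½TL, 3TL]}(t) dt = o(T log³ T)`
(`rodgers_tao_integrated_energy_bound`, used at `ε = 1`), the ordering of the positive-index
zeros for `t₀ < t ≤ 0` (§1.2) and their continuity in `t` (Thm. 4.1) give a good interval: natural
numbers `I₁ ∈ [0.8TL, 0.9TL]`, `I₂ ∈ [2.1TL, 2.2TL]` with `∫_{t₀/4}^0 boundaryEnergy T I₁ I₂ ≤
480 log³ T` for all large `T` (pigeonholing over the pairs of integer endpoints; see the module
docstring). [cite: RodgersTaoFMP2020, arXiv v5 Prop. 8.2] -/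
theorem goodIntervalBound_of_integrated_energy_bound (h72 : rodgers_tao_integrated_energy_bound)
    (hord : ∀ t₀ : ℝ, t₀ < 0 → HasOnlyRealZeros (deBruijnH t₀) →
      ∀ t ∈ Ioc t₀ 0, StrictMono fun j : ℕ ↦ deBruijnZero t (j + 1))
    (hcont : ∀ t₀ : ℝ, t₀ < 0 → HasOnlyRealZeros (deBruijnH t₀) →
      ∀ j : ℕ, ContinuousOn (fun t : ℝ ↦ deBruijnZero t (j + 1)) (Ioc t₀ 0))
    {t₀ : ℝ} (ht₀ : t₀ < 0) (hreal : HasOnlyRealZeros (deBruijnH t₀)) : GoodIntervalBound t₀ := by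
  classical
  obtain ⟨T₁, hT₁⟩ := h72 t₀ ht₀ hreal 1 one_pos
  have hev : ∀ᶠ T : ℝ in atTop, T₁ ≤ T ∧ Real.exp 1 ≤ T ∧ 40 ≤ T * Real.log T :=
    (eventually_ge_atTop T₁).and ((eventually_ge_atTop _).and
      ((tendsto_id.atTop_mul_atTop₀ Real.tendsto_log_atTop).eventually_ge_atTop _))
  obtain ⟨T₀, hT₀⟩ := eventually_atTop.1 hev
  refine ⟨3, 480, T₀, fun T hT ↦ ?_⟩
  obtain ⟨hTT₁, hTe, hTL⟩ := hT₀ T hT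
  set L : ℝ := Real.log T with hL_def
  have hT0 : 0 < T := (Real.exp_pos 1).trans_le hTe
  have hL1 : 1 ≤ L := (Real.le_log_iff_exp_le hT0).2 hTe
  have hTL10 : 10 ≤ T * L := by linarith
  have ht₀4 : t₀ / 4 ≤ 0 := by linarith
  -- Thm 7.2 at this height
  set big : Finset ℕ := Finset.Icc ⌈T * Real.log T / 2⌉₊ ⌊3 * T * Real.log T⌋₊ with hbig
  obtain ⟨hint, hI⟩ := hT₁ T hTT₁
  rw [one_mul] at hI
  -- candidate endpoints
  set P₁ : Finset ℕ := Finset.Icc ⌈4 / 5 * (T * L)⌉₊ ⌊9 / 10 * (T * L)⌋₊ with hP₁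
  set P₂ : Finset ℕ := Finset.Icc ⌈21 / 10 * (T * L)⌉₊ ⌊11 / 5 * (T * L)⌋₊ with hP₂
  have hP₁b : ∀ a ∈ P₁, 4 / 5 * (T * L) ≤ a ∧ (a : ℝ) ≤ 9 / 10 * (T * L) := by
    intro a ha
    rw [hP₁, Finset.mem_Icc] at ha
    exact ⟨(Nat.le_ceil _).trans (by exact_mod_cast ha.1),
      le_trans (by exact_mod_cast ha.2) (Nat.floor_le (by positivity))⟩
  have hP₂b : ∀ a ∈ P₂, 21 / 10 * (T * L) ≤ a ∧ (a : ℝ) ≤ 11 / 5 * (T * L) := by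
    intro a ha
    rw [hP₂, Finset.mem_Icc] at ha
    exact ⟨(Nat.le_ceil _).trans (by exact_mod_cast ha.1),
      le_trans (by exact_mod_cast ha.2) (Nat.floor_le (by positivity))⟩
  have hP₁a : ∀ a ∈ P₁, 4 / 5 * (T * L) ≤ a ∧ (a : ℝ) ≤ 11 / 5 * (T * L) :=
    fun a ha ↦ ⟨(hP₁b a ha).1, (hP₁b a ha).2.trans (by nlinarith)⟩
  have hP₂a : ∀ a ∈ P₂, 4 / 5 * (T * L) ≤ a ∧ (a : ℝ) ≤ 11 / 5 * (T * L) :=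
    fun a ha ↦ ⟨le_trans (by nlinarith) (hP₂b a ha).1, (hP₂b a ha).2⟩
  have hc₁ : T * L / 20 ≤ (P₁.card : ℝ) := by
    have := sub_sub_one_le_card_Icc (x := 4 / 5 * (T * L)) (y := 9 / 10 * (T * L)) (by positivity)
    rw [← hP₁] at this
    linarith
  have hc₂ : T * L / 20 ≤ (P₂.card : ℝ) := by
    have := sub_sub_one_le_card_Icc (x := 21 / 10 * (T * L)) (y := 11 / 5 * (T * L)) (by positivity)
    rw [← hP₂] at this
    linarith
  have hc₁0 : 0 < P₁.card := by
    have : (0 : ℝ) < P₁.card := by linarith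
    exact_mod_cast this
  have hc₂0 : 0 < P₂.card := by
    have : (0 : ℝ) < P₂.card := by linarith
    exact_mod_cast this
  have hne : (P₁ ×ˢ P₂).Nonempty :=
    Finset.Nonempty.product (Finset.card_pos.1 hc₁0) (Finset.card_pos.1 hc₂0)
  -- positivity of the indices in all windows at admissible endpoints
  have hwpos : ∀ a : ℕ, 4 / 5 * (T * L) ≤ a → (a : ℝ) ≤ 11 / 5 * (T * L) →
      ∀ n ∈ dyadicScales T, ∀ j ∈ Finset.Icc (a - 2 ^ n) (a + 2 ^ n), 1 ≤ j :=
    fun a ha ha' n hn ↦ (window_subset hTL10 ha ha' hn).2.2.2.2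
  -- the one-endpoint sums and the pointwise bound on `[t₀/4, 0]`
  set G : ℕ → ℝ → ℝ := fun a t ↦ ∑ n ∈ dyadicScales T,
    ((2 : ℝ) ^ n)⁻¹ * renormEnergyOn t (Finset.Icc (a - 2 ^ n) (a + 2 ^ n)) with hG
  have hbE : ∀ (a b : ℕ) (t : ℝ), boundaryEnergy T a b t = G a t + G b t := by
    intro a b t
    simp only [hG, boundaryEnergy_eq, mul_add, Finset.sum_add_distrib]
  have hpt : ∀ t ∈ Icc (t₀ / 4) 0,
      ∑ q ∈ P₁ ×ˢ P₂, boundaryEnergy T q.1 q.2 t ≤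
        12 * L * ((P₁.card : ℝ) + P₂.card) * renormEnergyOn t big := by
    intro t ht
    have hmono := hord t₀ ht₀ hreal t (Icc_quarter_subset_Ioc ht₀ ht)
    have h₁ := sum_windowEnergy_le hTL10 hTe hmono hP₁a
    have h₂ := sum_windowEnergy_le hTL10 hTe hmono hP₂a
    rw [← hbig] at h₁ h₂
    have hsum : ∑ q ∈ P₁ ×ˢ P₂, boundaryEnergy T q.1 q.2 t =
        P₂.card * ∑ a ∈ P₁, G a t + P₁.card * ∑ b ∈ P₂, G b t := by
      rw [Finset.sum_product]
      simp only [hbE]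
      have inner : ∀ x ∈ P₁, ∑ y ∈ P₂, (G x t + G y t) = P₂.card * G x t + ∑ y ∈ P₂, G y t := by
        intro x _
        rw [Finset.sum_add_distrib, Finset.sum_const, nsmul_eq_mul]
      rw [Finset.sum_congr rfl inner, Finset.sum_add_distrib, Finset.sum_const, nsmul_eq_mul,
        ← Finset.mul_sum]
    rw [hsum]
    have hc1 : (0 : ℝ) ≤ P₁.card := Nat.cast_nonneg _
    have hc2 : (0 : ℝ) ≤ P₂.card := Nat.cast_nonneg _
    have e₁ : P₂.card * ∑ a ∈ P₁, G a t ≤ P₂.card * (12 * L * renormEnergyOn t big) :=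
      mul_le_mul_of_nonneg_left h₁ hc2
    have e₂ : P₁.card * ∑ b ∈ P₂, G b t ≤ P₁.card * (12 * L * renormEnergyOn t big) :=
      mul_le_mul_of_nonneg_left h₂ hc1
    linarith
  -- integrability of the boundary energies (continuity on `[t₀/4, 0] ⊆ (t₀, 0]`)
  have hcontq : ∀ q ∈ P₁ ×ˢ P₂, ContinuousOn (boundaryEnergy T q.1 q.2) (Icc (t₀ / 4) 0) := by
    intro q hq
    rw [Finset.mem_product] at hq
    exact (continuousOn_boundaryEnergy (hord t₀ ht₀ hreal) (hcont t₀ ht₀ hreal)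
      (hwpos q.1 (hP₁a q.1 hq.1).1 (hP₁a q.1 hq.1).2)
      (hwpos q.2 (hP₂a q.2 hq.2).1 (hP₂a q.2 hq.2).2)).mono (Icc_quarter_subset_Ioc ht₀)
  have hintq : ∀ q ∈ P₁ ×ˢ P₂, IntervalIntegrable (boundaryEnergy T q.1 q.2) volume (t₀ / 4) 0 :=
    fun q hq ↦ ContinuousOn.intervalIntegrable (by rw [uIcc_of_le ht₀4]; exact hcontq q hq)
  have hintsum : IntervalIntegrable (fun t ↦ ∑ q ∈ P₁ ×ˢ P₂, boundaryEnergy T q.1 q.2 t)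
      volume (t₀ / 4) 0 :=
    ContinuousOn.intervalIntegrable (by
      rw [uIcc_of_le ht₀4]; exact continuousOn_finsetSum _ hcontq)
  -- integrate
  have hsumI : ∑ q ∈ P₁ ×ˢ P₂, ∫ t in (t₀ / 4)..0, boundaryEnergy T q.1 q.2 t ≤
      12 * L * ((P₁.card : ℝ) + P₂.card) * (T * L ^ 3) := by
    rw [← intervalIntegral.integral_finsetSum hintq]
    calc ∫ t in (t₀ / 4)..0, ∑ q ∈ P₁ ×ˢ P₂, boundaryEnergy T q.1 q.2 t
        ≤ ∫ t in (t₀ / 4)..0, 12 * L * ((P₁.card : ℝ) + P₂.card) * renormEnergyOn t big :=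
          intervalIntegral.integral_mono_on ht₀4 hintsum (hint.const_mul _) hpt
      _ = 12 * L * ((P₁.card : ℝ) + P₂.card) * ∫ t in (t₀ / 4)..0, renormEnergyOn t big :=
          intervalIntegral.integral_const_mul _ _
      _ ≤ 12 * L * ((P₁.card : ℝ) + P₂.card) * (T * L ^ 3) := by
          refine mul_le_mul_of_nonneg_left ?_ (by positivity)
          rw [hbig, hL_def]; exact hI
  -- pigeonhole a pair
  have hbudget : 12 * L * ((P₁.card : ℝ) + P₂.card) * (T * L ^ 3) ≤
      ∑ q ∈ P₁ ×ˢ P₂, (480 * L ^ 3 : ℝ) := by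
    rw [Finset.sum_const, nsmul_eq_mul, Finset.card_product, Nat.cast_mul]
    have hL0 : 0 ≤ L := by linarith
    have hL3 : 0 ≤ L ^ 3 := by positivity
    have key : 12 * L * ((P₁.card : ℝ) + P₂.card) * T ≤ 480 * ((P₁.card : ℝ) * P₂.card) := by
      nlinarith [mul_le_mul_of_nonneg_left hc₁ (by positivity : (0 : ℝ) ≤ 240 * P₂.card),
        mul_le_mul_of_nonneg_left hc₂ (by positivity : (0 : ℝ) ≤ 240 * P₁.card)]
    nlinarith [mul_le_mul_of_nonneg_right key hL3]
  obtain ⟨q, hq, hqle⟩ := Finset.exists_le_of_sum_le hne (hsumI.trans hbudget)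
  rw [Finset.mem_product] at hq
  have hL3 : Real.log T ^ (3 : ℝ) = L ^ 3 := by
    rw [← hL_def]; exact_mod_cast Real.rpow_natCast L 3
  refine ⟨q.1, q.2, (hP₁b q.1 hq.1).1, (hP₁b q.1 hq.1).2, (hP₂b q.2 hq.2).1, (hP₂b q.2 hq.2).2,
    hintq q (Finset.mem_product.2 hq), ?_⟩
  rw [hL3]
  exact hqle

/-! ## Prop. 8.1 from Thm. 7.2, Prop. 8.2 (v5) and Prop. 8.3 (v5) -/

/-- The time-stepping of the proof of Prop. 8.1 in the v5 form, at a fixed large `T`: from the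
propagation inequality (Prop. 8.3 (v5) at this `T` and this good interval `[J₁, J₂]`), a starting
time `t_* ∈ (t₀/4, 0]`, and `K = ⌈|t_*| · 100L²⌉` steps of length `|t_*|/K` with
`J₁ + K L³ ≤ TL` and `2TL ≤ J₂ − KL³`, one gets
`Ẽ^{[J₁ + KL³, J₂ − KL³]}(0) ≤ Ẽ^{[J₁, J₂]}(t_*) + K · C' L^A (1 + 2K L³)` (`C' = max(C, 0)`), the
`k`-th step being applied to the window `[J₁ + kL³, J₂ − kL³]`, at distance `kL³ ≤ KL³` from `I⁰`.
[cite: RodgersTaoFMP2020, arXiv v5 §8 (proof of Prop. 8.1)] -/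
theorem energy_propagation_to_zero_v5 {t₀ A C T ts J₁ J₂ : ℝ} {K : ℕ}
    (h83 : ∀ I₁ I₂ : ℝ, T * Real.log T / 2 ≤ I₁ → I₁ ≤ T * Real.log T →
      2 * T * Real.log T ≤ I₂ → I₂ ≤ 3 * T * Real.log T →
      ∀ t₁ t₂ : ℝ, t₀ / 4 ≤ t₁ → t₁ ≤ t₂ → t₂ ≤ 0 → t₂ ≤ t₁ + 1 / (100 * Real.log T ^ 2) →
        renormEnergyOn t₂ (Finset.Icc ⌈I₁ + Real.log T ^ 3⌉₊ ⌊I₂ - Real.log T ^ 3⌋₊) ≤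
          renormEnergyOn t₁ (Finset.Icc ⌈I₁⌉₊ ⌊I₂⌋₊) +
            C * Real.log T ^ A * (1 + |I₁ - J₁| + |I₂ - J₂|))
    (hL : 0 < Real.log T) (hts : t₀ / 4 < ts) (hts0 : ts ≤ 0)
    (hK : K = ⌈(-ts) * (100 * Real.log T ^ 2)⌉₊)
    (hJ₁ : T * Real.log T / 2 ≤ J₁) (hJ₁' : J₁ + K * Real.log T ^ 3 ≤ T * Real.log T)
    (hJ₂ : 2 * T * Real.log T ≤ J₂ - K * Real.log T ^ 3) (hJ₂' : J₂ ≤ 3 * T * Real.log T) :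
    renormEnergyOn 0 (Finset.Icc ⌈J₁ + K * Real.log T ^ 3⌉₊ ⌊J₂ - K * Real.log T ^ 3⌋₊) ≤
      renormEnergyOn ts (Finset.Icc ⌈J₁⌉₊ ⌊J₂⌋₊) +
        K * (max C 0 * Real.log T ^ A * (1 + 2 * K * Real.log T ^ 3)) := by
  set L : ℝ := Real.log T with hL_def
  -- the step length `h = |ts| / K`
  set h : ℝ := (-ts) / K with hh_def
  have hKge : (-ts) * (100 * L ^ 2) ≤ K := by rw [hK]; exact Nat.le_ceil _
  have hh0 : 0 ≤ h := div_nonneg (by linarith) (Nat.cast_nonneg K)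
  have hh1 : h ≤ 1 / (100 * L ^ 2) := by
    rw [le_div_iff₀ (by positivity), hh_def, div_mul_eq_mul_div]
    exact div_le_one_of_le₀ hKge (Nat.cast_nonneg K)
  have hKh : ts + K * h = 0 := by
    rcases Nat.eq_zero_or_pos K with hK0 | hKpos
    · have hts' : (-ts) * (100 * L ^ 2) ≤ 0 := by
        have := Nat.ceil_eq_zero.1 (hK ▸ hK0 : ⌈(-ts) * (100 * Real.log T ^ 2)⌉₊ = 0)
        exact this
      have : -ts ≤ 0 := by
        by_contra hcon
        have : 0 < (-ts) * (100 * L ^ 2) := mul_pos (lt_of_not_ge hcon) (by positivity)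
        linarith
      have hts00 : ts = 0 := le_antisymm hts0 (by linarith)
      simp [hK0, hts00]
    · rw [hh_def, mul_div_cancel₀ _ (Nat.cast_pos.2 hKpos).ne']
      ring_nf
  -- the iteration
  set E : ℕ → ℝ → ℝ → ℝ := fun k a b ↦ renormEnergyOn (ts + k * h) (Finset.Icc ⌈a⌉₊ ⌊b⌋₊)
    with hE_def
  set c : ℝ := max C 0 * L ^ A * (1 + 2 * K * L ^ 3) with hc_def
  have hK0 : (0 : ℝ) ≤ K := Nat.cast_nonneg K
  have hLA : 0 ≤ L ^ A := Real.rpow_nonneg hL.le _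
  have hstep : ∀ k : ℕ, k < K →
      E (k + 1) (J₁ + (k + 1) * L ^ 3) (J₂ - (k + 1) * L ^ 3) ≤
        E k (J₁ + k * L ^ 3) (J₂ - k * L ^ 3) + c := by
    intro k hk
    have hk1 : ((k : ℝ) + 1) ≤ K := by exact_mod_cast hk
    have hkK : (k : ℝ) ≤ K := by exact_mod_cast hk.le
    have hk0 : 0 ≤ (k : ℝ) * L ^ 3 := by positivity
    have hkK3 : (k : ℝ) * L ^ 3 ≤ K * L ^ 3 := mul_le_mul_of_nonneg_right hkK (by positivity)
    have h1 : T * L / 2 ≤ J₁ + k * L ^ 3 := by linarith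
    have h2 : J₁ + k * L ^ 3 ≤ T * L := by linarith
    have h3 : 2 * T * L ≤ J₂ - k * L ^ 3 := by linarith
    have h4 : J₂ - k * L ^ 3 ≤ 3 * T * L := by linarith
    have h5 : t₀ / 4 ≤ ts + k * h := by nlinarith
    have h6 : ts + k * h ≤ ts + (k + 1) * h := by nlinarith
    have h7 : ts + (k + 1) * h ≤ 0 := by
      have : ((k : ℝ) + 1) * h ≤ K * h := mul_le_mul_of_nonneg_right hk1 hh0
      linarith
    have h8 : ts + (k + 1) * h ≤ ts + k * h + 1 / (100 * L ^ 2) := by linarith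
    have hmain := h83 _ _ h1 h2 h3 h4 _ _ h5 h6 h7 h8
    have e1 : J₁ + k * L ^ 3 + L ^ 3 = J₁ + (k + 1) * L ^ 3 := by ring
    have e2 : J₂ - k * L ^ 3 - L ^ 3 = J₂ - (k + 1) * L ^ 3 := by ring
    have e3 : |J₁ + k * L ^ 3 - J₁| = k * L ^ 3 := by
      rw [show J₁ + k * L ^ 3 - J₁ = k * L ^ 3 by ring, abs_of_nonneg hk0]
    have e4 : |J₂ - k * L ^ 3 - J₂| = k * L ^ 3 := by
      rw [show J₂ - k * L ^ 3 - J₂ = -(k * L ^ 3) by ring, abs_neg, abs_of_nonneg hk0]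
    rw [e1, e2, e3, e4] at hmain
    -- the cost of this step is at most `c`
    have hcost : C * L ^ A * (1 + k * L ^ 3 + k * L ^ 3) ≤ c := by
      have hnn : 0 ≤ 1 + (k : ℝ) * L ^ 3 + k * L ^ 3 := by positivity
      calc C * L ^ A * (1 + k * L ^ 3 + k * L ^ 3)
          ≤ max C 0 * L ^ A * (1 + k * L ^ 3 + k * L ^ 3) :=
            mul_le_mul_of_nonneg_right (mul_le_mul_of_nonneg_right (le_max_left _ _) hLA) hnn
        _ ≤ max C 0 * L ^ A * (1 + 2 * K * L ^ 3) := by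
            refine mul_le_mul_of_nonneg_left (by linarith) (mul_nonneg (le_max_right _ _) hLA)
        _ = c := rfl
    simp only [hE_def]
    push_cast
    linarith
  have hfin := iterate_energy_propagation hstep K le_rfl
  simp only [hE_def, zero_mul, add_zero, sub_zero, Nat.cast_zero, hKh] at hfin
  exact hfin

/-- **Rodgers–Tao, Prop. 8.1 from Thm. 7.2 and Props. 8.2, 8.3 of arXiv v5** (the corrected
deduction printed in v5 after the statement of Prop. 8.3). Under `Λ < 0` (witness `t₀`): by
Thm. 7.2 (`rodgers_tao_integrated_energy_bound`) and pigeonholing there is a time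
`t_* ∈ (t₀/4, 0]` with `Ẽ^{[½TL, 3TL]}(t_*) = o(T log³ T)`, hence (monotonicity in the window,
the positive-index zeros being ordered at time `t_*`) `Ẽ^{I⁰}(t_*) = o(T log³ T)` for the good
interval `I⁰` of Prop. 8.2 (`GoodIntervalBound t₀`); applying Prop. 8.3 (`EnergyPropagationV5 t₀`)
`O(log² T)` times starting from `I⁰` costs
`O(log² T) · Õ(1 + O(log⁵ T)) = o(T log³ T)` and shrinks the window by `O(log⁵ T)`, so that it
still contains `[TL, 2TL]`; monotonicity of `Ẽ^I(0)` in `I` concludes. Stated at a fixed time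
`t₀ < 0`, with the conclusions of Thm. 7.2, Prop. 8.2 (v5) (`GoodIntervalBound t₀`) and Prop. 8.3
(v5) (`EnergyPropagationV5 t₀`) at `t₀` and the ordering of the positive-index zeros on `(t₀, 0]`
as hypotheses, and the conclusion of Prop. 8.1 (`Ẽ^{[TL, 2TL]}(0) ≤ ε T log³ T` for large `T`) as
conclusion: this records the deduction itself, whereas the fact-level implication
`… → rodgers_tao_energy_bound_zero` (this theorem at the witness `t₀` of `Λ < 0`, Prop. 8.2 (v5)
being supplied by `goodIntervalBound_of_integrated_energy_bound`) is subsumed by the tree theorem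
`rodgers_tao_energy_bound_zero_holds` (the tree refutes `Λ < 0`) and is not kept as a separate
declaration. [cite: RodgersTaoFMP2020, arXiv v5 Prop. 8.1 (proof)] -/
theorem energy_bound_zero_of_propagation_v5 {t₀ : ℝ} (ht₀ : t₀ < 0)
    (h72 : ∀ ε : ℝ, 0 < ε → ∃ T₀ : ℝ, ∀ T : ℝ, T₀ ≤ T →
      IntervalIntegrable
          (fun t ↦ renormEnergyOn t
            (Finset.Icc ⌈T * Real.log T / 2⌉₊ ⌊3 * T * Real.log T⌋₊))
          volume (t₀ / 4) 0 ∧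
        ∫ t in (t₀ / 4)..0, renormEnergyOn t
            (Finset.Icc ⌈T * Real.log T / 2⌉₊ ⌊3 * T * Real.log T⌋₊) ≤
          ε * (T * Real.log T ^ 3))
    (hgood : GoodIntervalBound t₀) (h83 : EnergyPropagationV5 t₀)
    (hord : ∀ t ∈ Ioc t₀ 0, StrictMono fun j : ℕ ↦ deBruijnZero t (j + 1)) :
    ∀ ε : ℝ, 0 < ε → ∃ T₀ : ℝ, ∀ T : ℝ, T₀ ≤ T →
      renormEnergyOn 0 (Finset.Icc ⌈T * Real.log T⌉₊ ⌊2 * T * Real.log T⌋₊) ≤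
        ε * (T * Real.log T ^ 3) := by
  intro ε hε
  obtain ⟨A₀, C₀, T₂, hgood'⟩ := hgood
  obtain ⟨A, C, T₃, h83'⟩ := h83 A₀ C₀
  have ht₀' : 0 < -t₀ := by linarith
  obtain ⟨T₁, h72'⟩ := h72 (ε * (-t₀) / 8) (by positivity)
  set C' : ℝ := max C 0 with hC'
  have hC'0 : 0 ≤ C' := le_max_right _ _
  -- the constant in front of the total cost `K · C' L^A (1 + 2KL³) ≤ M L^A L⁷`
  set M : ℝ := (25 * (-t₀) + 1) * (3 + 50 * (-t₀)) * C' with hM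
  have hM0 : 0 ≤ M := by positivity
  -- thresholds
  have hev : ∀ᶠ T : ℝ in atTop, T₁ ≤ T ∧ T₂ ≤ T ∧ T₃ ≤ T ∧ Real.exp 1 ≤ T ∧
      (2 * M / ε) * Real.log T ^ (A + 4) ≤ T ∧
      (10 * (25 * (-t₀) + 1)) * Real.log T ^ (4 : ℝ) ≤ T :=
    (eventually_ge_atTop T₁).and ((eventually_ge_atTop T₂).and ((eventually_ge_atTop T₃).and
      ((eventually_ge_atTop _).and
        ((eventually_mul_log_rpow_le _ _).and (eventually_mul_log_rpow_le _ _)))))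
  obtain ⟨T₀, hT₀⟩ := eventually_atTop.1 hev
  refine ⟨T₀, fun T hT ↦ ?_⟩
  obtain ⟨hTT₁, hTT₂, hTT₃, hTe, hpowA, hpow4⟩ := hT₀ T hT
  set L : ℝ := Real.log T with hL_def
  have hT0 : 0 < T := (Real.exp_pos 1).trans_le hTe
  have hL1 : 1 ≤ L := (Real.le_log_iff_exp_le hT0).2 hTe
  have hL0 : 0 < L := by linarith
  have hTL : 0 < T * L := by positivity
  -- the good interval at this height and Prop. 8.3 at this height
  obtain ⟨J₁, J₂, hJ₁lo, hJ₁hi, hJ₂lo, hJ₂hi, hJgood⟩ := hgood' T hTT₂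
  have h83T := h83' T hTT₃ J₁ J₂ hJ₁lo hJ₁hi hJ₂lo hJ₂hi hJgood
  -- Thm 7.2 and pigeonholing: a good starting time `ts`
  obtain ⟨hint, hI⟩ := h72' T hTT₁
  obtain ⟨ts, hts, hEts⟩ :=
    exists_le_div_of_intervalIntegral_le (by linarith : t₀ / 4 < 0) hint hI
  have hEts' : renormEnergyOn ts (Finset.Icc ⌈T * Real.log T / 2⌉₊ ⌊3 * T * Real.log T⌋₊) ≤
      ε / 2 * (T * L ^ 3) := by
    have : ε * (-t₀) / 8 * (T * Real.log T ^ 3) / (0 - t₀ / 4) = ε / 2 * (T * L ^ 3) := by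
      rw [← hL_def, div_eq_iff (by linarith : (0 : ℝ) - t₀ / 4 ≠ 0)]
      ring
    rwa [this] at hEts
  -- monotonicity at time `ts`: `Ẽ^{[J₁, J₂]}(ts) ≤ Ẽ^{[½TL, 3TL]}(ts)`
  have hmono_ts : renormEnergyOn ts (Finset.Icc ⌈(J₁ : ℝ)⌉₊ ⌊(J₂ : ℝ)⌋₊) ≤
      ε / 2 * (T * L ^ 3) := by
    have hsm := hord ts ⟨by linarith [hts.1], hts.2⟩
    refine le_trans (renormEnergyOn_mono_of_strictMono hsm ?_ ?_) hEts'
    · rw [Nat.ceil_natCast, Nat.floor_natCast]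
      refine Finset.Icc_subset_Icc (Nat.ceil_le.2 ?_) (Nat.le_floor ?_)
      · rw [← hL_def]; linarith
      · rw [← hL_def]; linarith
    · intro j hj
      rw [Finset.mem_Icc] at hj
      exact le_trans (Nat.one_le_ceil_iff.2 (by rw [← hL_def]; positivity)) hj.1
  -- number of steps
  set K : ℕ := ⌈(-ts) * (100 * Real.log T ^ 2)⌉₊ with hK_def
  have hKle : (K : ℝ) ≤ 25 * (-t₀) * L ^ 2 + 1 := by
    have h1 : (K : ℝ) < (-ts) * (100 * L ^ 2) + 1 :=
      Nat.ceil_lt_add_one (mul_nonneg (by linarith [hts.2]) (by positivity))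
    have h2 : (-ts) * (100 * L ^ 2) ≤ (-t₀) / 4 * (100 * L ^ 2) :=
      mul_le_mul_of_nonneg_right (by linarith [hts.1]) (by positivity)
    linarith
  -- `K L³ ≤ TL/10`, from `10 (25|t₀| + 1) L⁴ ≤ T`
  have hL4 : Real.log T ^ (4 : ℝ) = L ^ 4 := by
    rw [← hL_def]; exact_mod_cast Real.rpow_natCast L 4
  have hKL3 : (K : ℝ) * L ^ 3 ≤ T * L / 10 := by
    rw [hL4] at hpow4
    have h1 : (K : ℝ) * L ^ 3 ≤ (25 * (-t₀) * L ^ 2 + 1) * L ^ 3 :=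
      mul_le_mul_of_nonneg_right hKle (by positivity)
    have h2 : (25 * (-t₀) * L ^ 2 + 1) * L ^ 3 ≤ (25 * (-t₀) + 1) * L ^ 5 := by
      have hL3 : 1 ≤ L ^ 3 := one_le_pow₀ hL1
      have hL5 : L ^ 3 ≤ L ^ 5 := pow_le_pow_right₀ hL1 (by norm_num)
      nlinarith
    have h3 : (25 * (-t₀) + 1) * L ^ 5 ≤ T * L / 10 := by
      have := mul_le_mul_of_nonneg_right hpow4 (by positivity : (0 : ℝ) ≤ L / 10)
      nlinarith
    linarith
  -- propagate from `ts` to `0`, starting from `[J₁, J₂]`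
  have hprop := energy_propagation_to_zero_v5 (J₁ := (J₁ : ℝ)) (J₂ := (J₂ : ℝ)) h83T hL0 hts.1
    hts.2 hK_def (by rw [← hL_def]; linarith) (by rw [← hL_def]; linarith)
    (by rw [← hL_def]; linarith) (by rw [← hL_def]; linarith)
  rw [← hL_def] at hprop
  -- monotonicity at time `0` in the final window
  have hsm0 := hord 0 ⟨ht₀, le_rfl⟩
  have hsub : Finset.Icc ⌈T * L⌉₊ ⌊2 * T * L⌋₊ ⊆
      Finset.Icc ⌈(J₁ : ℝ) + K * L ^ 3⌉₊ ⌊(J₂ : ℝ) - K * L ^ 3⌋₊ :=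
    Finset.Icc_subset_Icc (Nat.ceil_mono (by rw [← hL_def] at hJ₁hi; linarith))
      (Nat.floor_mono (by rw [← hL_def] at hJ₂lo; linarith))
  have hpos : ∀ j ∈ Finset.Icc ⌈(J₁ : ℝ) + K * L ^ 3⌉₊ ⌊(J₂ : ℝ) - K * L ^ 3⌋₊, 1 ≤ j := by
    intro j hj
    rw [Finset.mem_Icc] at hj
    have : (0 : ℝ) < J₁ + K * L ^ 3 := by
      have : (0 : ℝ) < J₁ := lt_of_lt_of_le (by positivity) (hL_def ▸ hJ₁lo)
      positivity
    exact le_trans (Nat.one_le_ceil_iff.2 this) hj.1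
  have hmono0 := renormEnergyOn_mono_of_strictMono hsm0 hsub hpos
  -- the cost of the iteration: `K C' L^A (1 + 2KL³) ≤ (ε/2) T L³`
  have hcost : (K : ℝ) * (C' * L ^ A * (1 + 2 * K * L ^ 3)) ≤ ε / 2 * (T * L ^ 3) := by
    have hLA : 0 ≤ L ^ A := Real.rpow_nonneg hL0.le _
    have hK0 : (0 : ℝ) ≤ K := Nat.cast_nonneg K
    -- `1 + 2KL³ ≤ (3 + 50|t₀|) L⁵` and `K ≤ (25|t₀| + 1) L²`
    have hKle' : (K : ℝ) ≤ (25 * (-t₀) + 1) * L ^ 2 := by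
      have hL2 : 1 ≤ L ^ 2 := one_le_pow₀ hL1
      have e : (25 * (-t₀) + 1) * L ^ 2 = 25 * (-t₀) * L ^ 2 + L ^ 2 := by ring
      linarith
    have h1 : 1 + 2 * (K : ℝ) * L ^ 3 ≤ (3 + 50 * (-t₀)) * L ^ 5 := by
      have hL5 : 1 ≤ L ^ 5 := one_le_pow₀ hL1
      have e := mul_le_mul_of_nonneg_right hKle' (by positivity : (0 : ℝ) ≤ 2 * L ^ 3)
      have e1 : 2 * (K : ℝ) * L ^ 3 = K * (2 * L ^ 3) := by ring
      have e2 : (25 * (-t₀) + 1) * L ^ 2 * (2 * L ^ 3) + L ^ 5 = (3 + 50 * (-t₀)) * L ^ 5 := by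
        ring
      linarith
    have h2 : (K : ℝ) * (C' * L ^ A * (1 + 2 * K * L ^ 3)) ≤
        ((25 * (-t₀) + 1) * L ^ 2) * (C' * L ^ A * ((3 + 50 * (-t₀)) * L ^ 5)) := by
      have hA0 : 0 ≤ C' * L ^ A := mul_nonneg hC'0 hLA
      calc (K : ℝ) * (C' * L ^ A * (1 + 2 * K * L ^ 3))
          ≤ K * (C' * L ^ A * ((3 + 50 * (-t₀)) * L ^ 5)) :=
            mul_le_mul_of_nonneg_left (mul_le_mul_of_nonneg_left h1 hA0) hK0
        _ ≤ ((25 * (-t₀) + 1) * L ^ 2) * (C' * L ^ A * ((3 + 50 * (-t₀)) * L ^ 5)) :=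
            mul_le_mul_of_nonneg_right hKle' (mul_nonneg hA0 (by positivity))
    have h3 : ((25 * (-t₀) + 1) * L ^ 2) * (C' * L ^ A * ((3 + 50 * (-t₀)) * L ^ 5)) =
        M * L ^ A * L ^ 4 * L ^ 3 := by rw [hM]; ring
    -- `M L^A L⁴ ≤ (ε/2) T` from the threshold `(2M/ε) L^{A+4} ≤ T`
    have h4 : M * L ^ A * L ^ 4 ≤ ε / 2 * T := by
      have hsplit : Real.log T ^ (A + 4) = L ^ A * L ^ 4 := by
        rw [← hL_def, Real.rpow_add hL0, ← hL4, hL_def]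
      rw [hsplit, div_mul_eq_mul_div, div_le_iff₀ hε] at hpowA
      have e : 2 * M * (L ^ A * L ^ 4) = 2 * (M * L ^ A * L ^ 4) := by ring
      linarith
    calc (K : ℝ) * (C' * L ^ A * (1 + 2 * K * L ^ 3))
        ≤ M * L ^ A * L ^ 4 * L ^ 3 := h2.trans h3.le
      _ ≤ ε / 2 * T * L ^ 3 := mul_le_mul_of_nonneg_right h4 (by positivity)
      _ = ε / 2 * (T * L ^ 3) := by ring
  calc renormEnergyOn 0 (Finset.Icc ⌈T * Real.log T⌉₊ ⌊2 * T * Real.log T⌋₊)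
      ≤ renormEnergyOn 0 (Finset.Icc ⌈(J₁ : ℝ) + K * L ^ 3⌉₊ ⌊(J₂ : ℝ) - K * L ^ 3⌋₊) := by
        rw [← hL_def]; exact hmono0
    _ ≤ renormEnergyOn ts (Finset.Icc ⌈(J₁ : ℝ)⌉₊ ⌊(J₂ : ℝ)⌋₊) +
          K * (C' * L ^ A * (1 + 2 * K * L ^ 3)) := hprop
    _ ≤ ε / 2 * (T * L ^ 3) + ε / 2 * (T * L ^ 3) := add_le_add hmono_ts hcost
    _ = ε * (T * Real.log T ^ 3) := by rw [← hL_def]; ring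

end Literature.NumberTheory.LFunctions

end
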